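import Literature.Topology.PlaneTopology.SimpleArcs
import HarnessLib

/-!
# Cone exits: a convex cone corridor at the rim of a Schoenflies ball image and a three-segment
# cross-cut inside it (piece (T-A′ P1-exit) of stub T-A′
# `stub_carvedReduction_squeezeGeometry_domains`)

Crux `SAWDevelopingMap.ObservableToSLE` (stmt-CriticalPhenomena-10472), line `six-class-type-ladder`,
stub T-A′ `stub_carvedReduction_squeezeGeometry_domains`.  Landing target:
`Summits/CriticalPhenomena/SAWScalingLimit/Theorems/SAWDevelopingMapObservableToSLETypeLadderCarvedReductionSqueezeConeExit.lean`
(`--supports stmt-CriticalPhenomena-10472`; registered carrier `stub_carvedReduction_coneExit`).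

The window cross-cuts of the framed super-domain (`…SqueezeSuperFrame`) need, for each gate, an
EXIT: a small cross-cut `η` of the enlarged Jordan domain `J` lying (but for its endpoints) in the
far, lattice-free part of the corridor.  In the squeeze `J = H(ball 0 r₂) - τ` for the radial
Schoenflies family of `D` (twin `Squeeze.stub_carvedReduction_jordanApprox`, p130751), so it is
enough to treat a Jordan domain whose carrier is `f '' ball 0 r₂` and whose frontier is
`f '' sphere 0 r₂` for a homeomorphism `f` of `ℂ`.  For a unit direction `d` (in the squeeze:
the pre-image `u (D.mark i)` of the root), radii `1 ≤ r₁ < r₂` and an aperture `β ∈ (0, 1)`: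

* the CONE CORRIDOR `G = {w | r₁ < re (w d̄), ‖w‖ < r₂, (1 - β) ‖w‖ < re (w d̄)}` is open and
  convex, lies in the shell `r₁ < ‖w‖ < r₂`, and contains the ray points `s d`, `r₁ < s < r₂`
  (`coneCorridor_convex`, …);
* the three-segment polyline `[r₂ e₁, r'' e₁] ∪ [r'' e₁, r'' e₂] ∪ [r'' e₂, r₂ e₂]` through the
  two unit directions `e₁, e₂ = d (c ± i √(1 - c²))` close to `d` is a simple arc whose inner
  points lie in `G` (`isSimpleArc_conePolyline`, …);
* `stub_carvedReduction_coneExit` — hence `f '' G` is an open connected subset of `J` off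
  `f '' closedBall 0 r₁`, and `f` of the polyline is a cross-cut of `J` inside `f '' G` (but for
  its two endpoints, which lie on `f '' (sphere 0 r₂ ∩ cone)`).

Two such cones about unit directions `d₀ ≠ d₁` with aperture `β < 1 - ‖d₀ + d₁‖ / 2` are disjoint
(`coneCorridor_disjoint`), which separates the two gates' exits.
-/

noncomputable section
open scoped Topology ComplexConjugate
open Filter Set Metric
open Literature.Probability.RandomPlanarGeometry
open Literature.Topology.PlaneTopology

namespace Summit.CriticalPhenomena.SAWScalingLimit.Theorems.ObservableToSLE.TypeLadder

/-! ### The linear functional `re (w d̄)` and the cone corridor -/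

section Cone

variable {d : ℂ} {r₁ r₂ β : ℝ}

/-- `re (w d̄) ≤ ‖w‖` for a unit vector `d`. -/
theorem re_mul_conj_le_norm (hd : ‖d‖ = 1) (w : ℂ) : (w * conj d).re ≤ ‖w‖ := by
  have h1 : (w * conj d).re ≤ ‖w * conj d‖ := Complex.re_le_norm _
  rwa [norm_mul, Complex.norm_conj, hd, mul_one] at h1

/-- `re ((s u) d̄) = s re (u d̄)` for real `s`. -/
theorem re_smul_mul_conj (s : ℝ) (u d : ℂ) : ((s : ℂ) * u * conj d).re = s * (u * conj d).re := by
  rw [mul_assoc, Complex.re_ofReal_mul]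

/-- **The cone corridor is convex.** -/
theorem coneCorridor_convex (hβ : β < 1) :
    Convex ℝ {w : ℂ | r₁ < (w * conj d).re ∧ ‖w‖ < r₂ ∧ (1 - β) * ‖w‖ < (w * conj d).re} := by
  intro w₁ hw₁ w₂ hw₂ a b ha hb hab
  have hlin : ((a • w₁ + b • w₂) * conj d).re = a * (w₁ * conj d).re + b * (w₂ * conj d).re := by
    rw [Complex.real_smul, Complex.real_smul, add_mul, Complex.add_re, re_smul_mul_conj, re_smul_mul_conj]
  have hnorm : ‖a • w₁ + b • w₂‖ ≤ a * ‖w₁‖ + b * ‖w₂‖ := by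
    calc ‖a • w₁ + b • w₂‖ ≤ ‖a • w₁‖ + ‖b • w₂‖ := norm_add_le _ _
      _ = a * ‖w₁‖ + b * ‖w₂‖ := by rw [norm_smul, norm_smul, Real.norm_of_nonneg ha, Real.norm_of_nonneg hb]
  have h1β : 0 < 1 - β := by linarith
  rcases ha.lt_or_eq with ha' | ha'
  · have e1 : a * r₁ + b * r₁ = r₁ := by rw [← add_mul, hab, one_mul]
    have e2 : a * r₂ + b * r₂ = r₂ := by rw [← add_mul, hab, one_mul]
    have e3 : (1 - β) * (a * ‖w₁‖ + b * ‖w₂‖) = a * ((1 - β) * ‖w₁‖) + b * ((1 - β) * ‖w₂‖) := by ring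
    refine ⟨?_, ?_, ?_⟩
    · rw [hlin]
      linarith [mul_lt_mul_of_pos_left hw₁.1 ha', mul_le_mul_of_nonneg_left hw₂.1.le hb]
    · refine hnorm.trans_lt ?_
      linarith [mul_lt_mul_of_pos_left hw₁.2.1 ha', mul_le_mul_of_nonneg_left hw₂.2.1.le hb]
    · rw [hlin]
      have h4 := mul_le_mul_of_nonneg_left hnorm h1β.le
      linarith [mul_lt_mul_of_pos_left hw₁.2.2 ha', mul_le_mul_of_nonneg_left hw₂.2.2.le hb]
  · subst ha'
    simp only [zero_add] at hab
    subst hab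
    simpa using hw₂

/-- The cone corridor is open. -/
theorem coneCorridor_isOpen :
    IsOpen {w : ℂ | r₁ < (w * conj d).re ∧ ‖w‖ < r₂ ∧ (1 - β) * ‖w‖ < (w * conj d).re} := by
  have hL : Continuous fun w : ℂ => (w * conj d).re := Complex.continuous_re.comp (continuous_id.mul continuous_const)
  refine (isOpen_lt continuous_const hL).inter ((isOpen_lt continuous_norm continuous_const).inter
    (isOpen_lt (continuous_const.mul continuous_norm) hL))

/-- The cone corridor lies outside the closed ball of radius `r₁`. -/
theorem norm_gt_of_mem_coneCorridor (hd : ‖d‖ = 1) {w : ℂ}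
    (hw : w ∈ {w : ℂ | r₁ < (w * conj d).re ∧ ‖w‖ < r₂ ∧ (1 - β) * ‖w‖ < (w * conj d).re}) : r₁ < ‖w‖ :=
  hw.1.trans_le (re_mul_conj_le_norm hd w)

/-- The ray points `s d`, `r₁ < s < r₂`, lie in the cone corridor (`0 < β`, `0 ≤ r₁`). -/
theorem ray_mem_coneCorridor (hd : ‖d‖ = 1) (hr₁ : 0 ≤ r₁) (hβ : 0 < β) {s : ℝ} (hs₁ : r₁ < s)
    (hs₂ : s < r₂) :
    (s : ℂ) * d ∈ {w : ℂ | r₁ < (w * conj d).re ∧ ‖w‖ < r₂ ∧ (1 - β) * ‖w‖ < (w * conj d).re} := by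
  have hdd : (d * conj d).re = 1 := by
    rw [Complex.mul_conj, Complex.ofReal_re, Complex.normSq_eq_norm_sq, hd, one_pow]
  have hre : ((s : ℂ) * d * conj d).re = s := by rw [re_smul_mul_conj, hdd, mul_one]
  have hs0 : 0 < s := hr₁.trans_lt hs₁
  have hn : ‖(s : ℂ) * d‖ = s := by rw [norm_mul, Complex.norm_real, hd, mul_one, Real.norm_of_nonneg hs0.le]
  refine ⟨by rw [hre]; exact hs₁, by rw [hn]; exact hs₂, ?_⟩
  rw [hre, hn]; nlinarith

/-- **Two cone corridors about distinct unit directions are disjoint** for apertures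
`β < 1 - ‖d₀ + d₁‖ / 2`. -/
theorem coneCorridor_disjoint {d₀ d₁ : ℂ} {β : ℝ}
    (hβ : β ≤ 1 - ‖d₀ + d₁‖ / 2) {w : ℂ} (h₀ : (1 - β) * ‖w‖ < (w * conj d₀).re)
    (h₁ : (1 - β) * ‖w‖ < (w * conj d₁).re) : False := by
  have hsum : (w * conj d₀).re + (w * conj d₁).re ≤ ‖w‖ * ‖d₀ + d₁‖ := by
    have : (w * conj d₀).re + (w * conj d₁).re = (w * conj (d₀ + d₁)).re := by
      rw [map_add, mul_add, Complex.add_re]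
    rw [this]
    have h1 : (w * conj (d₀ + d₁)).re ≤ ‖w * conj (d₀ + d₁)‖ := Complex.re_le_norm _
    rwa [norm_mul, Complex.norm_conj] at h1
  have hw : 0 ≤ ‖w‖ := norm_nonneg _
  nlinarith [mul_le_mul_of_nonneg_left hβ hw]

end Cone

/-! ### The three-segment polyline -/

section Polyline

variable {d : ℂ} {c r'' r₂ : ℝ}

/-- The two unit directions `e± = d (c ± i √(1 - c²))` (`0 < c < 1`, `‖d‖ = 1`): unit vectors with
`re (e± d̄) = c`, distinct. -/
theorem coneDirections (hd : ‖d‖ = 1) (hc0 : 0 < c) (hc1 : c < 1) :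
    ‖d * (c + Real.sqrt (1 - c ^ 2) * Complex.I)‖ = 1 ∧ ‖d * (c - Real.sqrt (1 - c ^ 2) * Complex.I)‖ = 1 ∧
      (d * (c + Real.sqrt (1 - c ^ 2) * Complex.I) * conj d).re = c ∧
      (d * (c - Real.sqrt (1 - c ^ 2) * Complex.I) * conj d).re = c ∧
      d * (c + Real.sqrt (1 - c ^ 2) * Complex.I) ≠ d * (c - Real.sqrt (1 - c ^ 2) * Complex.I) := by
  set s : ℝ := Real.sqrt (1 - c ^ 2) with hs
  have hs0 : 0 < s := Real.sqrt_pos.2 (by nlinarith)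
  have hs2 : s ^ 2 = 1 - c ^ 2 := Real.sq_sqrt (by nlinarith)
  have hnp : ‖(c : ℂ) + s * Complex.I‖ = 1 := by
    rw [Complex.norm_eq_sqrt_sq_add_sq]; simp [hs2]
  have hnm : ‖(c : ℂ) - s * Complex.I‖ = 1 := by
    rw [Complex.norm_eq_sqrt_sq_add_sq]; simp [hs2]
  have hdd : d * conj d = 1 := by
    rw [Complex.mul_conj, Complex.normSq_eq_norm_sq, hd]; simp
  have hre : ∀ v : ℂ, (d * v * conj d).re = v.re := fun v => by
    rw [mul_comm d v, mul_assoc, hdd, mul_one]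
  have hd0 : d ≠ 0 := by rintro rfl; simp at hd
  refine ⟨by rw [norm_mul, hd, hnp, one_mul], by rw [norm_mul, hd, hnm, one_mul], by rw [hre]; simp,
    by rw [hre]; simp, fun heq => ?_⟩
  have := mul_left_cancel₀ hd0 heq
  have h2 : (2 * s : ℂ) * Complex.I = 0 := by linear_combination this
  simp [hs0.ne'] at h2

/-- A radial segment `[a e, b e]` (`e` a unit vector) consists of the points `t e`, `t` between
`a` and `b`. -/
theorem mem_radialSegment {e : ℂ} {a b : ℝ} (hab : a ≤ b) {w : ℂ} (hw : w ∈ segment ℝ ((a : ℂ) * e) ((b : ℂ) * e)) :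
    ∃ t : ℝ, a ≤ t ∧ t ≤ b ∧ w = (t : ℂ) * e := by
  rw [segment_eq_image'] at hw
  obtain ⟨θ, hθ, rfl⟩ := hw
  refine ⟨a + θ * (b - a), by nlinarith [hθ.1], by nlinarith [hθ.2], ?_⟩
  show ↑a * e + θ • (↑b * e - ↑a * e) = _
  rw [Complex.real_smul]; push_cast; ring

/-- **The three-segment polyline is a simple arc.**  For unit vectors `e₁ ≠ e₂` with
`re (e₁ d̄) = re (e₂ d̄) = c > 0` and radii `0 < r'' < r₂`, the polyline
`[r₂ e₁, r'' e₁] ∪ [r'' e₁, r'' e₂] ∪ [r'' e₂, r₂ e₂]` is a simple arc from `r₂ e₁` to `r₂ e₂`;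
every point `w` of it has `r'' c ≤ re (w d̄)`, `c ‖w‖ ≤ re (w d̄)` and `‖w‖ ≤ r₂`, with `‖w‖ = r₂`
only at the two endpoints. -/
theorem isSimpleArc_conePolyline {e₁ e₂ : ℂ} (he₁ : ‖e₁‖ = 1) (he₂ : ‖e₂‖ = 1)
    (hre₁ : (e₁ * conj d).re = c) (hre₂ : (e₂ * conj d).re = c) (hne : e₁ ≠ e₂) (hc0 : 0 < c)
    (hr : 0 < r'') (hr₂ : r'' < r₂) :
    IsSimpleArc (segment ℝ ((r₂ : ℂ) * e₁) ((r'' : ℂ) * e₁) ∪ segment ℝ ((r'' : ℂ) * e₁) ((r'' : ℂ) * e₂) ∪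
        segment ℝ ((r'' : ℂ) * e₂) ((r₂ : ℂ) * e₂)) ((r₂ : ℂ) * e₁) ((r₂ : ℂ) * e₂) ∧
      ∀ w ∈ segment ℝ ((r₂ : ℂ) * e₁) ((r'' : ℂ) * e₁) ∪ segment ℝ ((r'' : ℂ) * e₁) ((r'' : ℂ) * e₂) ∪
          segment ℝ ((r'' : ℂ) * e₂) ((r₂ : ℂ) * e₂),
        r'' * c ≤ (w * conj d).re ∧ c * ‖w‖ ≤ (w * conj d).re ∧ ‖w‖ ≤ r₂ ∧
          (‖w‖ = r₂ → w = (r₂ : ℂ) * e₁ ∨ w = (r₂ : ℂ) * e₂) := by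
  have hr₂0 : 0 < r₂ := hr.trans hr₂
  -- the functional on radial points and on the chord
  have hLrad : ∀ (t : ℝ) (e : ℂ), (e * conj d).re = c → ((t : ℂ) * e * conj d).re = t * c := fun t e he => by
    rw [re_smul_mul_conj, he]
  have hLchord : ∀ w ∈ segment ℝ ((r'' : ℂ) * e₁) ((r'' : ℂ) * e₂), (w * conj d).re = r'' * c := by
    intro w hw
    rw [segment_eq_image'] at hw
    obtain ⟨θ, -, rfl⟩ := hw
    show ((↑r'' * e₁ + θ • (↑r'' * e₂ - ↑r'' * e₁)) * conj d).re = r'' * c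
    have hexp : (↑r'' * e₁ + θ • (↑r'' * e₂ - ↑r'' * e₁)) * conj d =
        ↑r'' * (e₁ * conj d) + ↑θ * (↑r'' * (e₂ * conj d) - ↑r'' * (e₁ * conj d)) := by
      rw [Complex.real_smul]; ring
    rw [hexp]
    simp only [Complex.add_re, Complex.re_ofReal_mul, Complex.sub_re, hre₁, hre₂]
    ring
  have hnorm_rad : ∀ (t : ℝ) (e : ℂ), ‖e‖ = 1 → 0 ≤ t → ‖(t : ℂ) * e‖ = t := fun t e he ht => by
    rw [norm_mul, Complex.norm_real, he, mul_one, Real.norm_of_nonneg ht]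
  have hnorm_chord : ∀ w ∈ segment ℝ ((r'' : ℂ) * e₁) ((r'' : ℂ) * e₂), ‖w‖ ≤ r'' := by
    intro w hw
    have hconv : Convex ℝ (closedBall (0 : ℂ) r'') := convex_closedBall 0 r''
    have h1 : (r'' : ℂ) * e₁ ∈ closedBall (0 : ℂ) r'' := by
      rw [mem_closedBall, dist_zero_right, hnorm_rad r'' e₁ he₁ hr.le]
    have h2 : (r'' : ℂ) * e₂ ∈ closedBall (0 : ℂ) r'' := by
      rw [mem_closedBall, dist_zero_right, hnorm_rad r'' e₂ he₂ hr.le]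
    have := hconv.segment_subset h1 h2 hw
    rwa [mem_closedBall, dist_zero_right] at this
  -- the three segments are simple arcs
  have hseg1 : IsSimpleArc (segment ℝ ((r₂ : ℂ) * e₁) ((r'' : ℂ) * e₁)) ((r₂ : ℂ) * e₁) ((r'' : ℂ) * e₁) := by
    refine IsSimpleArc.segment fun heq => hr₂.ne' ?_
    have := congrArg (fun w => (w * conj d).re) heq
    simp only [hLrad r₂ e₁ hre₁, hLrad r'' e₁ hre₁] at this
    exact mul_right_cancel₀ hc0.ne' this
  have hseg2 : IsSimpleArc (segment ℝ ((r'' : ℂ) * e₁) ((r'' : ℂ) * e₂)) ((r'' : ℂ) * e₁) ((r'' : ℂ) * e₂) := by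
    refine IsSimpleArc.segment fun heq => hne ?_
    exact mul_left_cancel₀ (Complex.ofReal_ne_zero.2 hr.ne') heq
  have hseg3 : IsSimpleArc (segment ℝ ((r'' : ℂ) * e₂) ((r₂ : ℂ) * e₂)) ((r'' : ℂ) * e₂) ((r₂ : ℂ) * e₂) := by
    refine IsSimpleArc.segment fun heq => hr₂.ne ?_
    have := congrArg (fun w => (w * conj d).re) heq
    simp only [hLrad r₂ e₂ hre₂, hLrad r'' e₂ hre₂] at this
    exact mul_right_cancel₀ hc0.ne' this
  -- gluing
  have hglue : IsSimpleArc (segment ℝ ((r₂ : ℂ) * e₁) ((r'' : ℂ) * e₁) ∪ segment ℝ ((r'' : ℂ) * e₁) ((r'' : ℂ) * e₂) ∪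
      segment ℝ ((r'' : ℂ) * e₂) ((r₂ : ℂ) * e₂)) ((r₂ : ℂ) * e₁) ((r₂ : ℂ) * e₂) := by
    refine (hseg1.union hseg2 ?_).union hseg3 ?_
    · rintro w ⟨hw1, hw2⟩
      rw [segment_symm] at hw1
      obtain ⟨t, ht1, -, rfl⟩ := mem_radialSegment hr₂.le hw1
      have h1 := hLchord _ hw2
      rw [hLrad t e₁ hre₁] at h1
      have : t = r'' := mul_right_cancel₀ hc0.ne' h1
      rw [this]; rfl
    · rintro w ⟨hw12 | hw12, hw3⟩
      · exfalso
        rw [segment_symm] at hw12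
        obtain ⟨t, ht1, -, rfl⟩ := mem_radialSegment hr₂.le hw12
        obtain ⟨t', ht1', -, heq⟩ := mem_radialSegment hr₂.le hw3
        have hn := congrArg norm heq
        rw [hnorm_rad t e₁ he₁ (hr.le.trans ht1), hnorm_rad t' e₂ he₂ (hr.le.trans ht1')] at hn
        subst hn
        exact hne (mul_left_cancel₀ (Complex.ofReal_ne_zero.2 (hr.trans_le ht1).ne') heq)
      · obtain ⟨t, ht1, -, rfl⟩ := mem_radialSegment hr₂.le hw3
        have h1 := hLchord _ hw12
        rw [hLrad t e₂ hre₂] at h1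
        have : t = r'' := mul_right_cancel₀ hc0.ne' h1
        rw [this]; rfl
  refine ⟨hglue, fun w hw => ?_⟩
  rcases hw with (hw | hw) | hw
  · rw [segment_symm] at hw
    obtain ⟨t, ht1, ht2, rfl⟩ := mem_radialSegment hr₂.le hw
    have hn := hnorm_rad t e₁ he₁ (hr.le.trans ht1)
    refine ⟨by rw [hLrad t e₁ hre₁]; nlinarith, by rw [hLrad t e₁ hre₁, hn, mul_comm], by rw [hn]; exact ht2,
      fun hn' => Or.inl ?_⟩
    rw [hn] at hn'
    rw [hn']
  · have hL := hLchord w hw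
    have hn := hnorm_chord w hw
    refine ⟨hL.ge, by rw [hL]; nlinarith, hn.trans hr₂.le, fun hn' => ?_⟩
    exact absurd hn' (by linarith)
  · obtain ⟨t, ht1, ht2, rfl⟩ := mem_radialSegment hr₂.le hw
    have hn := hnorm_rad t e₂ he₂ (hr.le.trans ht1)
    refine ⟨by rw [hLrad t e₂ hre₂]; nlinarith, by rw [hLrad t e₂ hre₂, hn, mul_comm], by rw [hn]; exact ht2,
      fun hn' => Or.inr ?_⟩
    rw [hn] at hn'
    rw [hn']

end Polyline


/-! ### The cone exit -/

/-- **Registered carrier `stub_carvedReduction_coneExit`** (crux item stmt-CriticalPhenomena-10472,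
stub T-A′ `stub_carvedReduction_squeezeGeometry_domains`, piece CONE EXITS).  Let `J` be a Jordan
domain with carrier `f '' ball 0 r₂` and frontier `f '' sphere 0 r₂` for a homeomorphism `f` of
`ℂ`, `d` a unit direction, `0 ≤ r₁ < r₂`, `0 < β < 1`, and `G` the cone corridor
`{w | r₁ < re (w d̄), ‖w‖ < r₂, (1 - β) ‖w‖ < re (w d̄)}`.  Then there is a cross-cut `η` of `J`
whose inner points lie in `f '' G` and whose endpoints lie on `f '' (sphere 0 r₂ ∩ cone)`;
`f '' G` is open, connected, inside `J`, off `f '' closedBall 0 r₁`, and contains the ray points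
`f (s d)`, `r₁ < s < r₂`. -/
theorem stub_carvedReduction_coneExit :
    ∀ (J : JordanDomain) (f : ℂ ≃ₜ ℂ) (d : ℂ) (r₁ r₂ β : ℝ), ‖d‖ = 1 → 0 ≤ r₁ → r₁ < r₂ → 0 < β → β < 1 →
      J.carrier = f '' ball 0 r₂ → frontier J.carrier = f '' sphere 0 r₂ →
      ∃ (η : Set ℂ) (x₀ x₁ : ℂ), J.IsCrosscut η x₀ x₁ ∧
        η \ {x₀, x₁} ⊆ f '' {w : ℂ | r₁ < (w * conj d).re ∧ ‖w‖ < r₂ ∧ (1 - β) * ‖w‖ < (w * conj d).re} ∧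
        x₀ ∈ f '' {w : ℂ | ‖w‖ = r₂ ∧ (1 - β) * ‖w‖ < (w * conj d).re} ∧
        x₁ ∈ f '' {w : ℂ | ‖w‖ = r₂ ∧ (1 - β) * ‖w‖ < (w * conj d).re} ∧
        IsOpen (f '' {w : ℂ | r₁ < (w * conj d).re ∧ ‖w‖ < r₂ ∧ (1 - β) * ‖w‖ < (w * conj d).re}) ∧
        IsConnected (f '' {w : ℂ | r₁ < (w * conj d).re ∧ ‖w‖ < r₂ ∧ (1 - β) * ‖w‖ < (w * conj d).re}) ∧
        f '' {w : ℂ | r₁ < (w * conj d).re ∧ ‖w‖ < r₂ ∧ (1 - β) * ‖w‖ < (w * conj d).re} ⊆ J.carrier ∧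
        Disjoint (f '' {w : ℂ | r₁ < (w * conj d).re ∧ ‖w‖ < r₂ ∧ (1 - β) * ‖w‖ < (w * conj d).re})
          (f '' closedBall 0 r₁) ∧
        (∀ s : ℝ, r₁ < s → s < r₂ →
          f ((s : ℂ) * d) ∈ f '' {w : ℂ | r₁ < (w * conj d).re ∧ ‖w‖ < r₂ ∧ (1 - β) * ‖w‖ < (w * conj d).re}) := by
  intro J f d r₁ r₂ β hd hr₁ hr₁₂ hβ0 hβ1 hJ hfr
  set G : Set ℂ := {w : ℂ | r₁ < (w * conj d).re ∧ ‖w‖ < r₂ ∧ (1 - β) * ‖w‖ < (w * conj d).re} with hG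
  -- radii and aperture of the polyline
  set r'' : ℝ := (r₁ + r₂) / 2 with hr''
  have hr''0 : 0 < r'' := by rw [hr'']; linarith
  have hr''1 : r₁ < r'' := by rw [hr'']; linarith
  have hr''2 : r'' < r₂ := by rw [hr'']; linarith
  set cs : ℝ := max (1 - β) (r₁ / r'') with hcs
  have hcs1 : cs < 1 := max_lt (by linarith) ((div_lt_one hr''0).2 hr''1)
  have hcs0 : 0 < cs := lt_of_lt_of_le (by linarith) (le_max_left _ _)
  set c : ℝ := (1 + cs) / 2 with hc
  have hc0 : 0 < c := by rw [hc]; linarith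
  have hc1 : c < 1 := by rw [hc]; linarith
  have hcsc : cs < c := by rw [hc]; linarith
  have hcβ : 1 - β < c := (le_max_left _ _).trans_lt hcsc
  have hcr : r₁ < r'' * c := by
    have h1 : r₁ / r'' < c := (le_max_right _ _).trans_lt hcsc
    rw [div_lt_iff₀ hr''0] at h1; linarith
  obtain ⟨he₁, he₂, hre₁, hre₂, hne⟩ := coneDirections hd hc0 hc1
  set e₁ : ℂ := d * (c + Real.sqrt (1 - c ^ 2) * Complex.I) with he₁def
  set e₂ : ℂ := d * (c - Real.sqrt (1 - c ^ 2) * Complex.I) with he₂def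
  obtain ⟨hP, hPmem⟩ := isSimpleArc_conePolyline (d := d) (r₂ := r₂) he₁ he₂ hre₁ hre₂ hne hc0 hr''0 hr''2
  set P : Set ℂ := segment ℝ ((r₂ : ℂ) * e₁) ((r'' : ℂ) * e₁) ∪ segment ℝ ((r'' : ℂ) * e₁) ((r'' : ℂ) * e₂) ∪
    segment ℝ ((r'' : ℂ) * e₂) ((r₂ : ℂ) * e₂) with hPdef
  have hr₂0 : 0 < r₂ := hr₁.trans_lt hr₁₂
  have hnorm_end : ∀ e : ℂ, ‖e‖ = 1 → ‖(r₂ : ℂ) * e‖ = r₂ := fun e he => by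
    rw [norm_mul, Complex.norm_real, he, mul_one, Real.norm_of_nonneg hr₂0.le]
  -- inner points of the polyline lie in `G`
  have hinner : ∀ w ∈ P, w ≠ (r₂ : ℂ) * e₁ → w ≠ (r₂ : ℂ) * e₂ → w ∈ G := by
    intro w hw h1 h2
    obtain ⟨hL1, hL2, hn, hend⟩ := hPmem w hw
    have hn' : ‖w‖ < r₂ := lt_of_le_of_ne hn fun h => by
      rcases hend h with h' | h'
      · exact h1 h'
      · exact h2 h'
    have hw0 : 0 < ‖w‖ := by
      have : 0 < (w * conj d).re := by nlinarith
      exact norm_pos_iff.2 fun h0 => by rw [h0] at this; simp at this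
    refine ⟨by nlinarith, hn', ?_⟩
    nlinarith
  have hends : ∀ e : ℂ, ‖e‖ = 1 → (e * conj d).re = c →
      f ((r₂ : ℂ) * e) ∈ f '' {w : ℂ | ‖w‖ = r₂ ∧ (1 - β) * ‖w‖ < (w * conj d).re} := fun e he hre =>
    mem_image_of_mem f ⟨hnorm_end e he, by rw [hnorm_end e he, re_smul_mul_conj, hre]; nlinarith⟩
  have hGball : G ⊆ ball 0 r₂ := fun w hw => mem_ball_zero_iff.2 hw.2.1
  have hGJ : f '' G ⊆ J.carrier := by rw [hJ]; exact image_mono hGball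
  refine ⟨f '' P, f ((r₂ : ℂ) * e₁), f ((r₂ : ℂ) * e₂), ⟨hP.image f.continuous f.injective, ?_, ?_, ?_, ?_⟩,
    ?_, hends e₁ he₁ hre₁, hends e₂ he₂ hre₂, f.isOpenMap _ coneCorridor_isOpen, ?_, hGJ, ?_, fun s hs1 hs2 =>
    mem_image_of_mem f (ray_mem_coneCorridor hd hr₁ hβ0 hs1 hs2)⟩
  · rw [hfr]; exact mem_image_of_mem f (mem_sphere_zero_iff_norm.2 (hnorm_end e₁ he₁))
  · rw [hfr]; exact mem_image_of_mem f (mem_sphere_zero_iff_norm.2 (hnorm_end e₂ he₂))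
  · exact fun h => hne (mul_left_cancel₀ (Complex.ofReal_ne_zero.2 hr₂0.ne') (f.injective h))
  · rintro z ⟨⟨w, hw, rfl⟩, hz⟩
    refine hGJ ⟨w, hinner w hw ?_ ?_, rfl⟩
    · rintro rfl; exact hz (Or.inl rfl)
    · rintro rfl; exact hz (Or.inr rfl)
  · rintro z ⟨⟨w, hw, rfl⟩, hz⟩
    refine ⟨w, hinner w hw ?_ ?_, rfl⟩
    · rintro rfl; exact hz (Or.inl rfl)
    · rintro rfl; exact hz (Or.inr rfl)
  · have hne' : G.Nonempty := ⟨_, ray_mem_coneCorridor hd hr₁ hβ0 hr''1 hr''2⟩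
    exact ((coneCorridor_convex hβ1).isPathConnected hne').isConnected.image f f.continuous.continuousOn
  · refine (Set.disjoint_image_iff f.injective).2 (Set.disjoint_left.2 fun w hw hw' => ?_)
    have h1 := norm_gt_of_mem_coneCorridor hd hw
    rw [mem_closedBall, dist_zero_right] at hw'
    linarith

end Summit.CriticalPhenomena.SAWScalingLimit.Theorems.ObservableToSLE.TypeLadder

end
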